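import Mathlib.Algebra.Star.Basic
import Mathlib.Data.Real.Basic
import Mathlib.Tactic.Ring
import Mathlib.Tactic.LinearCombination
import Mathlib.Tactic.Linarith
import HarnessLib

/-!
# Venture HSemireg — the algebra of THEOREM 35-A′ (the first-column count in closed terms): completing the square,
# the adjugate identity `H[adj(H̄)y] = det H·(adj H)[y]`, and the vanishing of the `δ`-part (ENGINE-W PROBE5 §35 v4.1b) — kernel algebra

HONEST FRAMING. Lean index of the computation cell `pub-hsemireg`, widening group ENGINE-W (code A, seat `engine-w-1`,
gen 17). RING ALGEBRA of a binary sesquilinear form over a commutative ring with involution, and one real-number inequality; no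
abelian variety, sheaf, `Ext` group, secant structure or semiregularity map is constructed; nothing here says that HC, HC_CM or
HC_AV holds. Theorems only (0 `def`, 0 named fact, 0 `sorry`). New namespace `FirstColumn`.

SOURCE (the cell's own result): `widen/ENGINE-W/out/probe5/PROBE5-STIZ-A.md` §35 ADDENDUM v4.1b (engine-w-1 g10), **THEOREM 35-A′**
as printed: «(THE FIRST-COLUMN COUNT IN CLOSED TERMS, EVERY IMAGINARY NODE FIELD, EVERY CELL) … the number of admissible first columns
… equals `#{(z₀, z) ∈ O_K² × O_K², (z₀, z) ≠ 0 : H[z₀] + |m|·H[z] = t·d and H̄·(z₀ − A·z) ∈ t·d·O_K²}`. PROOF. In PROPOSITION 30.1's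
coordinates `x = u + μw̃` …: `𝒫[x] = tH~[u] + A·Tr H~(u, w̃) + N·H~[w̃] = t·H~[u + (A∕t)w̃] + (|m|∕t)·H~[w̃]` (complete the square;
`tN − A² = |m|`). Put `z := H̄~·w̃ ∈ O_K²` and `z₀ := t·H̄~·u + A·z ∈ O_K²`; then `H~[H̄~⁻¹y] = G[y]∕d` with `G = adj H~`, so
`t·d·𝒫[x] = G[z₀] + |m|·G[z]` … `𝒩(x) = 1 ⟺ 𝒫[x] = 1` (the δ-part of a totally positive element of `F⁺` with rational part `1`
vanishes: `|b|√(3|m|) < 1`, (β) of §31).» Conventions: `H = [[a, b],[b̄, c]]` with `a = ā`, `c = c̄`; `H[v] = vᵀHv̄ =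
a·v₁v̄₁ + b·v₁v̄₂ + b̄·v₂v̄₁ + c·v₂v̄₂`, `H(u,w) = uᵀHw̄`; `H̄ = [[a, b̄],[b, c]]`, `adj H̄ = [[c, −b̄],[−b, a]]`, `G = adj H = [[c, −b],
[−b̄, a]]`, `d = det H = ac − b b̄`; bars are `star`. What the kernel holds:

* §1 **`complete_square`** — `t·(t·H[u] + A·(H(u,w) + H(w,u)) + N·H[w]) = H[t·u + A·w] + (tN − A²)·H[w]` for `star`-fixed scalars `t, A`
  («complete the square; `tN − A² = |m|`»).
* §2 **`adjugate_value`** — `H[adj(H̄)·y] = d·G[y]` (hence `H[H̄⁻¹y] = G[y]∕d`), for `star`-fixed `a, c`; **`count_identity`** — with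
  `U := adj(H̄)·z₀`, `W := adj(H̄)·z` (`= d·(tu + Aw̃)`, `= d·w̃`): `H[U] + |m|·H[W] = d·(G[z₀] + |m|·G[z])` — the two sides of
  «`t·d·𝒫[x] = G[z₀] + |m|·G[z]`» up to the factor `d²∕(t·d)` recorded in the docstring.
* §3 **`delta_part_vanishes`** — for an integer `b` and a real `δ > 1` (`δ = √(3|m|) ≥ √3`): `1 − bδ > 0` and `1 + bδ > 0` force `b = 0`
  («`𝒩(x) = 1 ⟺ 𝒫[x] = 1`»); `delta_part_vanishes_trace` — the (β) form: `p ± bδ > 0`, `p ≤ 1` (`Tr = 2p ≤ 2`) ⟹ `b = 0`.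
WHAT IS NOT HERE: the lattice `Λ_X(H; A, N)`, the bijection `(u, w̃) ↔ (z₀, z)` as a statement about `O_K`-points, the count itself,
THEOREM 30-F. Tier of the source: hand ×1 (A) + machine 2 235∕2 235 + 118∕118 (×2 across codes as a formula, v4.2b).
-/

namespace Summit.Ventures.HSemireg.FirstColumn

/-! ## §1 Completing the square -/

/-- **«complete the square; `tN − A² = |m|`»**: for a binary sesquilinear form `H = [[a,b],[b̄,c]]` and `star`-fixed scalars `t, A`
(integers in the cell), `t·(t·H[u] + A·(H(u,w) + H(w,u)) + N·H[w]) = H[t·u + A·w] + (t·N − A²)·H[w]`. [kernel, `ring`] -/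
theorem complete_square {R : Type*} [CommRing R] [StarRing R] (a b c t A N u₁ u₂ w₁ w₂ : R)
    (ht : star t = t) (hA : star A = A) :
    t * (t * (a * u₁ * star u₁ + b * u₁ * star u₂ + star b * u₂ * star u₁ + c * u₂ * star u₂)
          + A * ((a * u₁ * star w₁ + b * u₁ * star w₂ + star b * u₂ * star w₁ + c * u₂ * star w₂)
                + (a * w₁ * star u₁ + b * w₁ * star u₂ + star b * w₂ * star u₁ + c * w₂ * star u₂))
          + N * (a * w₁ * star w₁ + b * w₁ * star w₂ + star b * w₂ * star w₁ + c * w₂ * star w₂))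
      = (a * (t * u₁ + A * w₁) * star (t * u₁ + A * w₁) + b * (t * u₁ + A * w₁) * star (t * u₂ + A * w₂)
          + star b * (t * u₂ + A * w₂) * star (t * u₁ + A * w₁) + c * (t * u₂ + A * w₂) * star (t * u₂ + A * w₂))
        + (t * N - A ^ 2) * (a * w₁ * star w₁ + b * w₁ * star w₂ + star b * w₂ * star w₁ + c * w₂ * star w₂) := by
  simp only [star_add, star_mul', ht, hA]
  ring

/-! ## §2 The adjugate identity and the count identity -/

/-- **«`H~[H̄~⁻¹y] = G[y]∕d` with `G = adj H~`»**, division-free: `H[adj(H̄)·y] = (ac − b b̄)·G[y]` where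
`adj(H̄)·y = (c·y₁ − b̄·y₂, −b·y₁ + a·y₂)` and `G[y] = c·y₁ȳ₁ − b·y₁ȳ₂ − b̄·y₂ȳ₁ + a·y₂ȳ₂` (`a, c` `star`-fixed). [kernel, `ring`] -/
theorem adjugate_value {R : Type*} [CommRing R] [StarRing R] (a b c y₁ y₂ : R) (ha : star a = a) (hc : star c = c) :
    (a * (c * y₁ - star b * y₂) * star (c * y₁ - star b * y₂) + b * (c * y₁ - star b * y₂) * star (-b * y₁ + a * y₂)
        + star b * (-b * y₁ + a * y₂) * star (c * y₁ - star b * y₂) + c * (-b * y₁ + a * y₂) * star (-b * y₁ + a * y₂))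
      = (a * c - b * star b) * (c * y₁ * star y₁ - b * y₁ * star y₂ - star b * y₂ * star y₁ + a * y₂ * star y₂) := by
  simp only [star_add, star_sub, star_mul', star_neg, star_star, ha, hc]
  ring

/-- **«`t·d·𝒫[x] = G[z₀] + |m|·G[z]`»**, division-free: with `U = adj(H̄)·z₀` and `W = adj(H̄)·z` (so `U = d·(tu + Aw̃)`, `W = d·w̃`
when `z = H̄w̃`, `z₀ = tH̄u + Az`), `H[U] + M·H[W] = (ac − b b̄)·(G[z₀] + M·G[z])` for any scalar `M` (`= |m|`); dividing by `d²` and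
using §1 (`t·𝒫 = H[tu + Aw̃] + |m|·H[w̃]`) gives the printed identity. [kernel] -/
theorem count_identity {R : Type*} [CommRing R] [StarRing R] (a b c M p₁ p₂ q₁ q₂ : R) (ha : star a = a) (hc : star c = c) :
    (a * (c * p₁ - star b * p₂) * star (c * p₁ - star b * p₂) + b * (c * p₁ - star b * p₂) * star (-b * p₁ + a * p₂)
        + star b * (-b * p₁ + a * p₂) * star (c * p₁ - star b * p₂) + c * (-b * p₁ + a * p₂) * star (-b * p₁ + a * p₂))
      + M * (a * (c * q₁ - star b * q₂) * star (c * q₁ - star b * q₂) + b * (c * q₁ - star b * q₂) * star (-b * q₁ + a * q₂)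
        + star b * (-b * q₁ + a * q₂) * star (c * q₁ - star b * q₂) + c * (-b * q₁ + a * q₂) * star (-b * q₁ + a * q₂))
      = (a * c - b * star b) * ((c * p₁ * star p₁ - b * p₁ * star p₂ - star b * p₂ * star p₁ + a * p₂ * star p₂)
          + M * (c * q₁ * star q₁ - b * q₁ * star q₂ - star b * q₂ * star q₁ + a * q₂ * star q₂)) := by
  rw [adjugate_value a b c p₁ p₂ ha hc, adjugate_value a b c q₁ q₂ ha hc]
  ring

/-! ## §3 The `δ`-part of a norm-one vector vanishes -/

/-- **«`𝒩(x) = 1 ⟺ 𝒫[x] = 1` (the δ-part of a totally positive element of `F⁺` with rational part `1` vanishes: `|b|√(3|m|) < 1`)»**: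
if `b ∈ ℤ`, `δ > 1` (e.g. `δ = √(3|m|) ≥ √3`) and both conjugates `1 − bδ`, `1 + bδ` are positive, then `b = 0`. [kernel] -/
theorem delta_part_vanishes (b : ℤ) (δ : ℝ) (hδ : 1 < δ) (h₁ : 0 < 1 - (b : ℝ) * δ) (h₂ : 0 < 1 + (b : ℝ) * δ) : b = 0 := by
  by_contra hb
  rcases Int.ne_iff_lt_or_gt.1 hb with hlt | hgt
  · have hb1 : b ≤ -1 := by omega
    have : (b : ℝ) ≤ -1 := by exact_mod_cast hb1
    nlinarith
  · have hb1 : 1 ≤ b := by omega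
    have : (1 : ℝ) ≤ b := by exact_mod_cast hb1
    nlinarith

/-- The (β) form of §31: a totally positive `p + bδ` (`p − bδ > 0`, `p + bδ > 0`) with half-trace `p ≤ 1`, `b ∈ ℤ` and `δ > 1` has
`b = 0` (and then `p > 0`). [kernel] -/
theorem delta_part_vanishes_trace (b : ℤ) (p δ : ℝ) (hδ : 1 < δ) (hp : p ≤ 1) (h₁ : 0 < p - (b : ℝ) * δ)
    (h₂ : 0 < p + (b : ℝ) * δ) : b = 0 := by
  by_contra hb
  rcases Int.ne_iff_lt_or_gt.1 hb with hlt | hgt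
  · have hb1 : b ≤ -1 := by omega
    have : (b : ℝ) ≤ -1 := by exact_mod_cast hb1
    nlinarith
  · have hb1 : 1 ≤ b := by omega
    have : (1 : ℝ) ≤ b := by exact_mod_cast hb1
    nlinarith

end Summit.Ventures.HSemireg.FirstColumn
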